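import Mathlib
import HarnessLib
import Summits.HubbardSuperconductivity.HubbardSuperconductivity.Theorems.KLProgrammeKLRegimeEngineTowerWeightedPkgOfNumW4
import Summits.HubbardSuperconductivity.HubbardSuperconductivity.Theorems.KLProgrammeKLRegimeEngineV17F2ClosersGQ

/-!
# Route `KLProgramme` — crux K3 ENGINE (stmt-HubbardSuperconductivity-20437 `KLRegimeEngineV17F2`), registration V2 (α1) image 27cd7ed0f55f17c0,
# row (b) `stub_engine_step_norms` (digest e78dfb33d2f7): THE ROW AS A TREE THEOREM MODULO ITS FOUR E1-CLASS PRODUCER HYPOTHESES, BY TYPE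
# (cell gate-hubbard-kl, seat p3 g24; p3 g23's (b)-closer census rev 5a, pen (R460)(A), p1b g19 CLOSING-MAP rev 9)

WHY.  After ♯4 (C p716153 → D″ p722189 → E″ p723000 → F″ p723554), numW4 (p723584), `EngineV8.hW_of_numW4` (p724031), `hexT_uncapped_of_weighted_e4_klEngGeo14`
(p706671) and the closer of record `EngineV8.A24a1G14.stub_engine_step_norms_of_producers` (p710057), row (b) closes BY NAME as
`stub_engine_step_norms_of_producers (hexT_uncapped_of_weighted_e4_klEngGeo14 (hW_of_numW4 hE₁) hE4) hexI hexG` — every factor a tree theorem, the residual being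
exactly FOUR producer hypotheses with no supplier in the tree (all E1-class model estimates at the flow frame `K_n`):
* `hE₁` — E1's d-free row family under `hW`'s binders and E1's own doors `cE UE` (dag E-206): **(E2)** the input-family sectorised two-leg cell of `𝒱_i[K_n]` at `F_{i−1}`,
  c-class `≤ (s₂u·|U| + s₂c·cc)·4^{−(i−1)}`; **(E4)** the `klScaleWt_i`-weighted plain four-leg line of `𝒱_i[K_n]`, λ-class `≤ s₄·ε_i`; **(E6)** the input-family sectorised
  six-leg cell `≤ S₆·ε_i²·2^{4i}` — for every level `1 ≤ i ≤ n` (the face of `hW_of_numW4`, verbatim);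
* `hE4` — the (E4) first-moments witness `∃ Eu, 0 ≤ Eu.1 ∧ (∀ …, 0 < Eu.2 …) ∧ E4FlowAt Eu.1 Eu.2` (E-b3: fed by `e4FlowAt_of_wtTupleLine` from the U-currency weighted
  per-tuple line `WtTupleLineAt … (K_n) n`; no supplier);
* `hexI` — the iso-moment witness `∃ Edu, … ∧ IsoMomFlowAt Edu.1 Edu.2.1 Edu.2.2` (Λ_m-weighted pinned first moments of the standard isotropic quartic tuples of `𝒱_n[K_n]`,
  absolute leading constant; no supplier);
* `hexG` — the grid two-leg moments producer `∀ P R, P.WF → R.WF2 → ∃ e, IsGridLitPkg R e ∧ TwoLegGridMomentsStepCT P R (klEngQ7 P R) klEngGeo14 e.1 e.2.1 e.2.2`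
  (telescope bricks landed modulo per-slice two-leg grid masses; no packaged supplier).
This file states the one-application term as ONE theorem whose hypothesis TYPES are those four binders verbatim and whose conclusion is row (b)'s registered text
verbatim (= the conclusion of `A24a1G14.stub_engine_step_norms_of_producers`), so that the row's residual is readable BY TYPE from one tree declaration
(the registrant's closing term reads `A24a1G14.stub_engine_step_norms_of_E1rows hE₁ hE4 hexI hexG` in the `rowB` slot of `R16V2Rows.KLRegimeEngineV17F2_of_rows`).
* **`A24a1G14.stub_engine_step_norms_of_E1rows hE₁ hE4 hexI hexG`** ⊢ row (b) verbatim.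
Bookkeeping only (one application of landed theorems); the four hypotheses are E1-class rows with NO supplier in the tree; nothing here asserts them, row (b),
any stub of 20437, K3, U₀, the window or superconductivity.  References: BGM 2006 §2.8 (2.76)–(2.84), Lemma 2.5 (2.98), §3 (3.2)–(3.8)
[cite: BenfattoGiulianiMastropietro2006].
-/

noncomputable section

namespace Summit.HubbardSuperconductivity.HubbardSuperconductivity.Theorems.EngineV8.A24a1G14

set_option linter.dupNamespace false -- summit = problem name (single-conjunct summit), D-0017

open Classical
open Real Finset Literature.MathematicalPhysics.QuantumLattice Literature.Probability.LatticeModels GrassmannAlgebra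
open Literature.MathematicalPhysics.QuantumLattice.FermiRG
open Summit.HubbardSuperconductivity.HubbardSuperconductivity.Theorems.KLProgrammeLegKernels
open Summit.HubbardSuperconductivity.HubbardSuperconductivity.Theorems.KLRegimeSplit
open Summit.HubbardSuperconductivity.HubbardSuperconductivity.Theorems.DispersionFlow
open Summit.HubbardSuperconductivity.HubbardSuperconductivity.Theorems.EngineV8

/-- **ROW (b) OF THE V2 (α1) REGISTRATION (digest e78dfb33d2f7) MODULO ITS FOUR E1-CLASS PRODUCER HYPOTHESES, BY TYPE**: `hE₁` = E1's d-free (E2) ∧ (E4) ∧ (E6) row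
family under `hW`'s binders (the face of `EngineV8.hW_of_numW4`, verbatim), `hE4` = the (E4) first-moments witness (`E4FlowAt`), `hexI` = the iso-moment witness
(`IsoMomFlowAt`), `hexG` = the grid two-leg moments producer (`TwoLegGridMomentsStepCT` package) ⊢ row (b) verbatim — the one-application term of record
`stub_engine_step_norms_of_producers (hexT_uncapped_of_weighted_e4_klEngGeo14 (hW_of_numW4 hE₁) hE4) hexI hexG`.
[cite: BenfattoGiulianiMastropietro2006, §2.8 (2.76)-(2.84), Lemma 2.5 (2.98), §3 (3.2)-(3.8)] -/
theorem stub_engine_step_norms_of_E1rows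
    (hE₁ : ∀ (P : SplitConsts) (R : RenConsts), P.WF → R.WF2 →
      ∃ s₂u s₂c s₄ S₆ : ℝ, 0 ≤ s₂u ∧ 0 ≤ s₂c ∧ 0 ≤ s₄ ∧ 0 ≤ S₆ ∧ ∃ cE UE : ℝ, 0 < cE ∧ 0 < UE ∧
      ∀ (Q : EngConsts) (cc : ℝ), 0 < cc → cc ≤ klEngC₃6 P R → cc ≤ cE →
      ∀ μ ∈ klWindowC, ∀ U : ℝ, 0 < U → U ≤ klEngU₀10 P R cc → U ≤ UE →
      ∀ β : ℝ, klBetaMin ≤ β → β ≤ Real.exp (cc / U ^ 2) →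
      ∀ (L M : ℕ) [NeZero L] [NeZero M], klEngL₄ P R β U ≤ L → klEngM₃ β U L ≤ M →
      ∀ n : ℕ, 1 ≤ n → n ≤ nScales β + 1 → IsKLRegime U cc (-(n : ℤ)) →
      HistP klPredsV17F2 L M klEngGeo14 P Q R β U μ 0 n →
      (∀ m, 1 ≤ m → m < n → FlowPieceOscAt L M (klReadOscC P R) β U μ m) →
      FrameOK R U (nScales β) μ (klFlowFrameU L M β U μ n) →
      (∀ j ≤ n, LevelsUExportMixedAt L M (klCU2 P R (klEngQ7 P R)) P β U μ j) →
      (∀ i, 1 ≤ i → i ≤ n → ∀ (q : Fin 2) (w : SpaceTimeIdx L M × SectorLeg (sectorCount (i - 1))),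
        klWtPinnedSumOf L M β μ (klFlowFrameU L M β U μ n) (i - 1) 2 (klEffectiveAction L M β U μ (klFlowFrameU L M β U μ n) klE0 i) q w ≤
          (s₂u * |U| + s₂c * cc) * ((4 : ℝ) ^ (i - 1))⁻¹) ∧
      (∀ i, 1 ≤ i → i ≤ n → ∀ (q : Fin 4) (τ' : Fin 4 → SectorLeg 1) (y' : SpaceTimeIdx L M),
        imagTimeWeight β M ^ 3 * ∑ x' ∈ univ.filter (fun x' : Fin 4 → SpaceTimeIdx L M => x' q = y'),
          klScaleWt L M β i ((univ.image x').image (fun x : SpaceTimeIdx L M => (((((2 * (x.1 : ℕ) : ℕ)) : ZMod (2 * (2 * M)))), x.2))) *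
            ‖sectorisedKernel L M β (trivialMultiplier L M) (klEffectiveAction L M β U μ (klFlowFrameU L M β U μ n) klE0 i) 4 τ' x'‖ ≤ s₄ * epsCoupling P U i) ∧
      (∀ i, 1 ≤ i → i ≤ n → ∀ (q : Fin 6) (w : SpaceTimeIdx L M × SectorLeg (sectorCount (i - 1))),
        klWtPinnedSumOf L M β μ (klFlowFrameU L M β U μ n) (i - 1) 6 (klEffectiveAction L M β U μ (klFlowFrameU L M β U μ n) klE0 i) q w ≤
          S₆ * epsCoupling P U i ^ 2 * (2 : ℝ) ^ (4 * i)))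
    (hE4 : ∃ Eu : ℝ × (GeoConsts → SplitConsts → RenConsts → EngConsts → ℝ → ℝ),
      0 ≤ Eu.1 ∧ (∀ G P R Q cc, 0 < Eu.2 G P R Q cc) ∧ E4FlowAt Eu.1 Eu.2)
    (hexI : ∃ Edu : ℝ × (SplitConsts → RenConsts → ℝ) × (GeoConsts → SplitConsts → RenConsts → EngConsts → ℝ → ℝ),
      0 ≤ Edu.1 ∧ (∀ P R, 0 ≤ Edu.2.1 P R) ∧ (∀ G P R Q cc, 0 < Edu.2.2 G P R Q cc) ∧ IsoMomFlowAt Edu.1 Edu.2.1 Edu.2.2)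
    (hexG : ∀ (P : SplitConsts) (R : RenConsts), P.WF → R.WF2 →
      ∃ e : (ℝ × ℝ × ℝ) × (EngConsts → ℝ → ℝ) × ℝ, IsGridLitPkg R e ∧ TwoLegGridMomentsStepCT P R (klEngQ7 P R) klEngGeo14 e.1 e.2.1 e.2.2) :
    ∀ (P : SplitConsts) (R : RenConsts) (c : ℝ), P.WF → R.WF2 → 0 < c → c ≤ klEngC₃7GU klEngGeo14 P R →
      ∀ μ ∈ klWindowC, ∀ U : ℝ, 0 < U → U ≤ klEngU₀12GQ klEngGeo14 (klEngQ9dG klEngGeo14 P R) P R c → ∀ β : ℝ, klBetaMin ≤ β → β ≤ Real.exp (c / U ^ 2) →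
        ∀ (L M : ℕ) [NeZero L] [NeZero M], klEngL₄ P R β U ≤ L → klEngM₃ β U L ≤ M →
          ∀ n : ℕ, 1 ≤ n → n ≤ nScales β + 1 → IsKLRegime U c (-(n : ℤ)) →
            HistP klPredsV17F2 L M klEngGeo14 P (klEngQ9dG klEngGeo14 P R) R β U μ 0 n →
              (∀ m, 1 ≤ m → m < n → FlowPieceOscAt L M (klReadOscC P R) β U μ m) →
              FrameOK R U (nScales β) μ (klFlowFrameU L M β U μ n) →
                (∀ j ≤ n, LevelsUExportMixedAt L M (klCU2 P R (klEngQ7 P R)) P β U μ j) →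
                  KernelNormsV4 L M P (klEngQ9dG klEngGeo14 P R) β U μ (klFlowFrameU L M β U μ n) n ∧
                    (∀ j ≤ n, (KernelNormsLevels L M P (klEngQ9dG klEngGeo14 P R) β U μ (klFlowFrameU L M β U μ n) j ∧
                      KernelNormsWt4 L M (klWtBudget P (klEngQ9dG klEngGeo14 P R) U j) β U μ (klFlowFrameU L M β U μ n) j)) ∧
                    EngineFirstMoments L M klEngGeo14 P (klEngQ9dG klEngGeo14 P R) β U μ (klFlowFrameU L M β U μ n) n ∧
                    IsoFirstMomentsAt L M klIsoMomC (klIsoMomD P R) P β U μ n ∧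
                    TwoLegGridFlowMomentsAtC L M (klZtG klEngGeo14 P R) (klZs1G klEngGeo14 P R) (klZs2G klEngGeo14 P R) c β U μ n :=
  stub_engine_step_norms_of_producers (hexT_uncapped_of_weighted_e4_klEngGeo14 (hW_of_numW4 hE₁) hE4) hexI hexG

end Summit.HubbardSuperconductivity.HubbardSuperconductivity.Theorems.EngineV8.A24a1G14

end
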